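import Mathlib
import Summits.QuantumFields.YangMills.Theorems.BalabanUVNodesN15OperatorReadout
import Literature.MathematicalPhysics.QuantumFieldTheory.Balaban1983to89.T4EtaRateDefectSite
import HarnessLib

/-!
# Route «BalabanUVNodes» (K4 «SpineRates»), node N15 = NE2 — THE SITE-LAYER READOUT in the lineage's currency: block majorants of a family of SITE-LATTICE
# operators ⇒ the node's SECOND CONJUNCT `T4EtaRate.EtaRateIneqSite` ∕ `NE2PlusSite` BY NAME, on n15-b's realised [B9] geometry `opGeo g X blk` — for ANY
# background carrier (the site twin of `…N15OperatorReadout`)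

Cell `pub-ymgap`, seat `pub-ymgap-dag-n15-c` (generation g5; R134 ACCELERATION SEAT, strategy s1; HUMAN RULING D-0062; chair R424 venue; `bears_on: R4∕N15`).  Filed
`--supports stmt-QuantumFields-20292 --as helper` (K3⁗; count-neutral).  Imports n15-b's `…N15OperatorReadout` (`opGeo`, `opGeo_len`, `rateFactor_opGeo`,
`realisedInstance`) and the cell record's `T4EtaRateDefectSite` (`entry`, `entry_le_of_hasMaj`) BY NAME; nothing in the tree is modified.

THE SEAM THIS CLOSES.  `T4EtaRateDefectSite` (cell `pub-balaban`) reads block majorants into the typed site layer in the B9-FIRST currency (a `B9.Geometry g₉`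
turned into a block geometry by `B9Thm34Ext.toB6 g₉ R H`, kernels `defectKernel ι D` along a section `ι` of the fine block map); n15-b's `…N15OperatorReadout`
reads the OPERATOR layer in the B6-FIRST currency the whole N15 background lineage runs in (a block geometry `g : B6.Geometry`, lattices blocked into it, the
[B9] geometry REALISED as `opGeo g X blk` — the `gc` of every paired-instance family of n15-a∕-b∕-c: `bgInstance`, `bgVecInstance₁`, `gaugeVecInstanceM`,
`v1VecInstance`, `v1GVecInstance`, …).  No SITE-layer readout existed in that currency; this file is it, so that the dressed site kernels of this seat's
`…N15BackgroundSiteNeumann` ∕ `…SiteWords` (operators on the site-lattice functions `Y → ℝ`, `Y` blocked by `blkY : Y → 𝔅`) can be read as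
`B9.SiteKernel (opGeo g X blk) B` and their block majorants as `EtaRateIneqSite` ∕ `NE2PlusSite` on the SAME paired instances whose operator layer is
already a theorem — the three conjuncts of `N15At` must sit on ONE family `pi`.

THE PRINT (SHAPE only).  [Balaban1985BackgroundPropagators] Thm 3.2 (3.48) p. 398: *«|(Q′(U)G′²(U)Q′*(U))⁻¹(y, y′)| ≦ B₀(L^jη)^{−4}(L^{j′}η)^{−d}e^{−δ₀d(y,y′)},
y, y′ ∈ 𝔅»* — a POINTWISE kernel bound on 𝔅 × 𝔅; the typed η-rate shape `T4EtaRate.EtaRateIneqSite d p` is this with the row's max-rate-factor (NOT PRINTED).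

CONTENTS ([folklore] plumbing + bookkeeping; 1 def).
* §1 `siteKernelOf blk blkY T : B9.SiteKernel (opGeo g X blk) B` — the kernel of a family `T U : (Y → ℝ) →ₗ (Y → ℝ)` of site-lattice operators at the pair of
  [B9] sites `(y, y′)` := the LARGEST matrix entry `|T U(δ_{x′})(x)|` over the block pair (`blkY x = y`, `blkY x′ = y′`; `0` on an empty pair);
  `siteKernelOf_nonneg`, `abs_entry_le_siteKernelOf` (every entry is read — non-vacuity), `siteKernelOf_le_of_hasMaj` (a block majorant `K ≥ 0` bounds it:
  `T4EtaRateDefectSite.entry_le_of_hasMaj`).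
* §2 PRODUCERS: `etaRateIneqSite_opGeo_of_hasMaj` (one configuration, exact (3.48) shape with the max-rate-factor), `etaRateIneqSite_opGeo_of_hasMaj_rateWeight`
  (from the defect calculus' source-weighted currency `c·e^{−δd}·w_γ(y′)`, `c ≤ C·(L^jη)^{−p}(L^{j′}η)^{−d}`).
* §3 `ne2PlusSite_opGeo_of_hasMaj`, `ne2PlusSite_opGeo_of_hasMaj_rateWeight` — the node's SECOND conjunct BY NAME for a family of realised instances
  (`OperatorReadout.realisedInstance`) over ANY backgrounds and pairings, from UNIFORM block majorants under the very quantifier block of `NE2PlusSite`.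

HONEST FRAMING ∕ LIMITS.  Typing + bookkeeping: nothing about Bałaban's operators is asserted and no majorant is proved here (they are binders — produced for the
dressed site kernel by this seat's S1∕S2 and instantiated in the sequel).  NE2⁺ NOT PRINTED, NOT proved; count-neutral (typed 28∕28; discharged count unchanged);
N15 NOT discharged; one finite T⁴ at fixed ε — NOT infinite volume, NOT OS on ℝ⁴, NOT a mass gap, NOT Clay.
-/

noncomputable section

namespace Summit.QuantumFields.YangMills.BalabanUVNodes.N15.SiteLayer

open Literature.MathematicalPhysics.QuantumFieldTheory.Balaban1983to89
open Literature.MathematicalPhysics.QuantumFieldTheory.Balaban1983to89.B11SectG (BlockNorm HasMaj)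
open Literature.MathematicalPhysics.QuantumFieldTheory.Balaban1983to89.T4EtaRate (PairedInstance EtaPairing EtaRateIneqSite NE2PlusSite rateFactor)
open Literature.MathematicalPhysics.QuantumFieldTheory.Balaban1983to89.T4EtaRateDefect (rateWeight)
open Literature.MathematicalPhysics.QuantumFieldTheory.Balaban1983to89.T4EtaRateDefectSite (entry entry_le_of_hasMaj)
open Summit.QuantumFields.YangMills.BalabanUVNodes.N15.OperatorReadout (opGeo opGeo_len rateFactor_opGeo realisedInstance)

/-! ## §1 The site kernel of a family of site-lattice operators -/

section Kernel

variable {g : B6.Geometry} {X Y : Type} [Fintype X] [Fintype Y] [DecidableEq Y] (blk : X → g.Site) (blkY : Y → g.Site) {B : B9.Backgrounds}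

/-- THE SITE KERNEL OF A FAMILY `T U : (Y → ℝ) →ₗ (Y → ℝ)` of site-lattice operators (in applications the η-DIFFERENCE `𝔇(D′, D) = D′ − D` of the two runs'
dressed site kernels), on n15-b's realised geometry: at the [B9] sites `(y, y′)` the LARGEST matrix entry `|T U(δ_{x′})(x)|` over the block pair `blkY x = y`,
`blkY x′ = y′` (`0` over an empty pair). [cite: Balaban1985BackgroundPropagators, Thm 3.2 (3.48) p.398 (shape: a pointwise kernel on 𝔅 × 𝔅)] -/
def siteKernelOf (T : B.Cfg → ((Y → ℝ) →ₗ[ℝ] (Y → ℝ))) : B9.SiteKernel (opGeo g X blk) B where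
  ker U y y' := by
    classical
    exact ⨆ p : Y × Y, if blkY p.1 = y ∧ blkY p.2 = y' then |entry (T U) p.1 p.2| else 0

omit [Fintype Y] in
/-- Unfolding. [folklore] -/
theorem siteKernelOf_ker (T : B.Cfg → ((Y → ℝ) →ₗ[ℝ] (Y → ℝ))) (U : B.Cfg) (y y' : g.Site) :
    (siteKernelOf blk blkY T).ker U y y' = by
      classical
      exact ⨆ p : Y × Y, if blkY p.1 = y ∧ blkY p.2 = y' then |entry (T U) p.1 p.2| else 0 := rfl

omit [Fintype Y] in
/-- The site kernel is non-negative. [folklore] -/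
theorem siteKernelOf_nonneg (T : B.Cfg → ((Y → ℝ) →ₗ[ℝ] (Y → ℝ))) (U : B.Cfg) (y y' : g.Site) : 0 ≤ (siteKernelOf blk blkY T).ker U y y' := by
  classical
  rw [siteKernelOf_ker]
  exact Real.iSup_nonneg fun p => by split_ifs <;> simp [abs_nonneg]

/-- NON-VACUITY: every matrix entry of `T U` is read — `|T U(δ_{x′})(x)| ≤ ker U (blkY x) (blkY x′)`. [folklore] -/
theorem abs_entry_le_siteKernelOf (T : B.Cfg → ((Y → ℝ) →ₗ[ℝ] (Y → ℝ))) (U : B.Cfg) (x x' : Y) :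
    |entry (T U) x x'| ≤ (siteKernelOf blk blkY T).ker U (blkY x) (blkY x') := by
  classical
  rw [siteKernelOf_ker]
  have hb : BddAbove (Set.range fun p : Y × Y =>
      if blkY p.1 = blkY x ∧ blkY p.2 = blkY x' then |entry (T U) p.1 p.2| else 0) := Finite.bddAbove_range _
  have := le_ciSup hb (x, x')
  simpa using this

/-- **READOUT**: a block majorant `K ≥ 0` of `T U` between the sharp block norms of `blkY` bounds the site kernel, `ker U y y′ ≤ K y y′`
(`T4EtaRateDefectSite.entry_le_of_hasMaj`). [folklore] -/
theorem siteKernelOf_le_of_hasMaj (T : B.Cfg → ((Y → ℝ) →ₗ[ℝ] (Y → ℝ))) (U : B.Cfg) {K : g.Site → g.Site → ℝ} (hK : ∀ a b, 0 ≤ K a b)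
    (h : HasMaj (BlockNorm.ofBlocks g blkY) (BlockNorm.ofBlocks g blkY) (T U) K) (y y' : g.Site) :
    (siteKernelOf blk blkY T).ker U y y' ≤ K y y' := by
  classical
  rw [siteKernelOf_ker]
  refine Real.iSup_le (fun p => ?_) (hK y y')
  split_ifs with hp
  · rw [← hp.1, ← hp.2]
    exact entry_le_of_hasMaj blkY blkY h p.1 p.2
  · exact hK y y'

end Kernel

/-! ## §2 Producers: block majorants ⇒ the site layer at one configuration -/

section Producers

variable {g : B6.Geometry} {X Y : Type} [Fintype X] [Fintype Y] [DecidableEq Y] (blk : X → g.Site) (blkY : Y → g.Site) {B : B9.Backgrounds}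

/-- **PRODUCER, one configuration, exact (3.48) shape.**  If `T U` has the block majorant `C·(L^jη)^{−p}(L^{j′}η)^{−d}·e^{−δd(y,y′)}·max(rf(y), rf(y′))` between the
sharp block norms of the site lattice (`C ≥ 0`, `η, L ≥ 0`), the site kernel satisfies `T4EtaRate.EtaRateIneqSite d p` on the realised geometry. [cite: Balaban1985BackgroundPropagators, Thm 3.2 (3.48) p.398 (shape)] -/
theorem etaRateIneqSite_opGeo_of_hasMaj (hη : 0 ≤ g.eta) (hL : 0 ≤ g.L) {d : ℕ} {p C δ γ : ℝ} (hC : 0 ≤ C)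
    (T : B.Cfg → ((Y → ℝ) →ₗ[ℝ] (Y → ℝ))) (U : B.Cfg)
    (h : HasMaj (BlockNorm.ofBlocks g blkY) (BlockNorm.ofBlocks g blkY) (T U)
      (fun y y' => C * (opGeo g X blk).len y ^ (-p) * (opGeo g X blk).len y' ^ (-(d : ℝ)) * Real.exp (-(δ * g.dist y y')) *
        max (rateFactor (opGeo g X blk) γ y) (rateFactor (opGeo g X blk) γ y'))) :
    EtaRateIneqSite d p (siteKernelOf blk blkY T) C δ γ U := by
  intro y y'
  have hlen : ∀ z : g.Site, 0 ≤ (opGeo g X blk).len z := fun z => by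
    rw [opGeo_len]
    exact mul_nonneg (pow_nonneg hL _) hη
  have hK : ∀ a b : g.Site, 0 ≤ C * (opGeo g X blk).len a ^ (-p) * (opGeo g X blk).len b ^ (-(d : ℝ)) * Real.exp (-(δ * g.dist a b)) *
      max (rateFactor (opGeo g X blk) γ a) (rateFactor (opGeo g X blk) γ b) := fun a b =>
    mul_nonneg (mul_nonneg (mul_nonneg (mul_nonneg hC (Real.rpow_nonneg (hlen a) _)) (Real.rpow_nonneg (hlen b) _)) (Real.exp_nonneg _))
      ((T4EtaRate.rateFactor_nonneg (g := opGeo g X blk) hη hL γ a).trans (le_max_left _ _))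
  rw [abs_of_nonneg (siteKernelOf_nonneg blk blkY T U y y')]
  exact siteKernelOf_le_of_hasMaj blk blkY T U hK h y y'

/-- **PRODUCER from the defect calculus' currency.**  A SOURCE-WEIGHTED block majorant `c·e^{−δd(y,y′)}·w_γ(y′)` (`w_γ = T4EtaRateDefect.rateWeight g γ`, what
the lineage's defect computations produce) with `0 ≤ c ≤ C·(L^jη)^{−p}(L^{j′}η)^{−d}` at every pair of sites gives `EtaRateIneqSite d p` with `(C, δ, γ)`
(`η, L > 0`; the source factor is one of the two in the `max`). [folklore] -/
theorem etaRateIneqSite_opGeo_of_hasMaj_rateWeight (hη : 0 < g.eta) (hL : 0 < g.L) {d : ℕ} {p C δ γ c : ℝ} (hC : 0 ≤ C) (hc : 0 ≤ c)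
    (hcC : ∀ y y' : g.Site, c ≤ C * g.len y ^ (-p) * g.len y' ^ (-(d : ℝ))) (T : B.Cfg → ((Y → ℝ) →ₗ[ℝ] (Y → ℝ))) (U : B.Cfg)
    (h : HasMaj (BlockNorm.ofBlocks g blkY) (BlockNorm.ofBlocks g blkY) (T U) (fun y y' => c * Real.exp (-(δ * g.dist y y')) * rateWeight g γ y')) :
    EtaRateIneqSite d p (siteKernelOf blk blkY T) C δ γ U := by
  refine etaRateIneqSite_opGeo_of_hasMaj blk blkY hη.le hL.le hC T U (h.mono fun y y' => ?_)
  rw [← rateFactor_opGeo g X blk hη.ne' hL γ y']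
  simp only [opGeo_len]
  have hE : 0 ≤ Real.exp (-(δ * g.dist y y')) := Real.exp_nonneg _
  have hrf : 0 ≤ rateFactor (opGeo g X blk) γ y' := T4EtaRate.rateFactor_nonneg (g := opGeo g X blk) hη.le hL.le γ y'
  calc c * Real.exp (-(δ * g.dist y y')) * rateFactor (opGeo g X blk) γ y'
      ≤ (C * g.len y ^ (-p) * g.len y' ^ (-(d : ℝ))) * Real.exp (-(δ * g.dist y y')) * rateFactor (opGeo g X blk) γ y' :=
        mul_le_mul_of_nonneg_right (mul_le_mul_of_nonneg_right (hcC y y') hE) hrf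
    _ ≤ (C * g.len y ^ (-p) * g.len y' ^ (-(d : ℝ))) * Real.exp (-(δ * g.dist y y')) *
          max (rateFactor (opGeo g X blk) γ y) (rateFactor (opGeo g X blk) γ y') :=
        mul_le_mul_of_nonneg_left (le_max_right _ _) (mul_nonneg (hc.trans (hcC y y')) hE)

end Producers

/-! ## §3 The node's second conjunct BY NAME for a family of realised instances over ANY backgrounds -/

section Node

variable {I : Type} (g : I → B6.Geometry) (X : I → Type) [∀ i, Fintype (X i)] (Y : I → Type) [∀ i, Fintype (Y i)] [∀ i, DecidableEq (Y i)]
  (blk : ∀ i, X i → (g i).Site) (blkY : ∀ i, Y i → (g i).Site) (gf : I → B9.Geometry) (Bc Bf : I → B9.Backgrounds)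
  (pair : ∀ i, EtaPairing (opGeo (g i) (X i) (blk i)) (gf i) (Bc i) (Bf i))
  (T : ∀ i, (Bf i).Cfg → ((Y i → ℝ) →ₗ[ℝ] (Y i → ℝ)))

/-- **THE NODE'S SECOND CONJUNCT BY NAME.**  For a family of realised instances (`OperatorReadout.realisedInstance`, the SAME family whose operator layer the
tree proves) over ANY background carriers: UNIFORM constants `M₅, δ, a₀, C, γ > 0` and, for `M ≥ M₅`, `0 < α₀`, `Mα₀ ≤ a₀` and every (3.35)-regular fine
configuration `U`, the (3.48)-shaped block majorant of `T i U` with the max-rate-factor (`η, L ≥ 0`) ⟹ `T4EtaRate.NE2PlusSite d p c35 pi (site kernels)`. [cite: Balaban1985BackgroundPropagators, Thm 3.2 (3.48) p.398 + Thm 3.14 pp.426–427 (quantifier template)] -/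
theorem ne2PlusSite_opGeo_of_hasMaj (d : ℕ) (p c35 : ℝ) (hη : ∀ i, 0 ≤ (g i).eta) (hL : ∀ i, 0 ≤ (g i).L)
    (h : ∃ M₅ δ a₀ C γ : ℝ, 0 < M₅ ∧ 0 < δ ∧ 0 < a₀ ∧ 0 < C ∧ 0 < γ ∧
      ∀ i : I, M₅ ≤ (gf i).M → ∀ α₀ : ℝ, 0 < α₀ → (gf i).M * α₀ ≤ a₀ →
        ∀ U : (Bf i).Cfg, (Bf i).Reg335 c35 α₀ U →
          HasMaj (BlockNorm.ofBlocks (g i) (blkY i)) (BlockNorm.ofBlocks (g i) (blkY i)) (T i U)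
            (fun y y' => C * (opGeo (g i) (X i) (blk i)).len y ^ (-p) * (opGeo (g i) (X i) (blk i)).len y' ^ (-(d : ℝ)) *
              Real.exp (-(δ * (g i).dist y y')) * max (rateFactor (opGeo (g i) (X i) (blk i)) γ y) (rateFactor (opGeo (g i) (X i) (blk i)) γ y'))) :
    NE2PlusSite d p c35 (realisedInstance g X blk gf Bc Bf pair) (fun i => siteKernelOf (blk i) (blkY i) (T i)) := by
  obtain ⟨M₅, δ, a₀, C, γ, hM₅, hδ, ha₀, hC, hγ, hall⟩ := h
  refine ⟨M₅, δ, a₀, C, γ, hM₅, hδ, ha₀, hC, hγ, fun i hM α₀ hα₀ ha U hU => ?_⟩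
  exact etaRateIneqSite_opGeo_of_hasMaj (blk i) (blkY i) (hη i) (hL i) hC.le (T i) U (hall i hM α₀ hα₀ ha U hU)

/-- **THE NODE'S SECOND CONJUNCT BY NAME, source-weighted currency.**  The same from hypotheses in the currency the lineage's defect computations run in: a
source-weighted majorant `c·e^{−δd}·w_γ(y′)` with UNIFORM `0 ≤ c ≤ C·(L^jη)^{−p}(L^{j′}η)^{−d}` (`η, L > 0` on every instance) ⟹ `NE2PlusSite d p c35 pi …`. [folklore] -/
theorem ne2PlusSite_opGeo_of_hasMaj_rateWeight (d : ℕ) (p c35 : ℝ) (hη : ∀ i, 0 < (g i).eta) (hL : ∀ i, 0 < (g i).L)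
    (h : ∃ M₅ δ a₀ C γ c : ℝ, 0 < M₅ ∧ 0 < δ ∧ 0 < a₀ ∧ 0 < C ∧ 0 < γ ∧ 0 ≤ c ∧
      (∀ (i : I) (y y' : (g i).Site), c ≤ C * (g i).len y ^ (-p) * (g i).len y' ^ (-(d : ℝ))) ∧
      ∀ i : I, M₅ ≤ (gf i).M → ∀ α₀ : ℝ, 0 < α₀ → (gf i).M * α₀ ≤ a₀ →
        ∀ U : (Bf i).Cfg, (Bf i).Reg335 c35 α₀ U →
          HasMaj (BlockNorm.ofBlocks (g i) (blkY i)) (BlockNorm.ofBlocks (g i) (blkY i)) (T i U)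
            (fun y y' => c * Real.exp (-(δ * (g i).dist y y')) * rateWeight (g i) γ y')) :
    NE2PlusSite d p c35 (realisedInstance g X blk gf Bc Bf pair) (fun i => siteKernelOf (blk i) (blkY i) (T i)) := by
  obtain ⟨M₅, δ, a₀, C, γ, c, hM₅, hδ, ha₀, hC, hγ, hc, hcC, hall⟩ := h
  refine ⟨M₅, δ, a₀, C, γ, hM₅, hδ, ha₀, hC, hγ, fun i hM α₀ hα₀ ha U hU => ?_⟩
  exact etaRateIneqSite_opGeo_of_hasMaj_rateWeight (blk i) (blkY i) (hη i) (hL i) hC.le hc (hcC i) (T i) U (hall i hM α₀ hα₀ ha U hU)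

end Node

end Summit.QuantumFields.YangMills.BalabanUVNodes.N15.SiteLayer

end
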